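import Mathlib
import Literature.NumberTheory.Sieve.ParityBarrier

/-!
# Transfer for the fan decorrelation crux (line `SketchIdeator1`)

Stub `stub_fanFromLaws` of the crux `FanDecorrelation`
(`Summit.Parity.GeneralizedHardyLittlewood.Theses.LiouvilleMAD`), line `SketchIdeator1`
(idea `lag-window-normal-form`): the TRANSFER, pure bookkeeping.

Notation (informal; nothing is defined in this file, every statement is written out over Mathlib):
`Q = ⌊√M⌋ + 1`, `λ = ArithmeticFunction.liouville`, and for `k : ℤ` the fan sum is
`R_k(n,n',c;M) = Σ_{j ∈ [Q,2Q)} Σ_{(m,m') ∈ (M,2M]², m − m' = k j} λ(mn+c) λ(m'n'+c)`;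
for `1 ≤ k` and a class `r < k` the unit fan is
`U_r = Σ_{(y,y') ∈ ((M−r)/k,(2M−r)/k]², y − y' ∈ [Q,2Q)} λ((ky+r)n+c) λ((ky'+r)n'+c)`.

`stub_fanFromLaws`: residue splitting (`R_k = Σ_{r<k} U_r` for `1 ≤ k ≤ M`), the lag-window
law at some `δ > 0` (`|U_r| ≤ C₁ M^{1−κ}/k` for `1 ≤ k ≤ M^{1/2−δ}`) and the fan-window coset law
at the same `δ` (`|Σ_{r<q} U_r| ≤ C₂ M^{3/4+ϑ₂}` for `M^{1/2−δ} ≤ q < 2Q`) imply the body of the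
route declaration `FanDecorrelation`: `|R_k| ≤ C M^{3/4+ϑ}` for some `ϑ < 1/4`, all `k ≠ 0`.

Proof: `ϑ = max (max ϑ₂ (1/4 − κ)) 0`, `C = max (max C₁ C₂) 512`.  For `k ≥ 1`: if `M < 8`
the trivial bound `|R_k| ≤ Q·M² ≤ 147`; if `k ≤ M^{1/2−δ}` split into classes and sum the
per-class bound; if `k ≥ 2Q` the fan is empty (`kj ≥ 2Q·Q > 2M > m − m'`); otherwise
`M^{1/2−δ} < k < 2Q ≤ M` and the coset law applies with `q = k`.  Negative `k`:
`R_{−k}(n,n') = R_k(n',n)` by the swap `(m,m') ↦ (m',m)`.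

Design: a `Theorems` support file declares no definitions, so the helper lemmas are stated on the
written-out sums.  Adapted from the kernel-checked sketch
`Cruxes/FanDecorrelation/SketchIdeator1.lean` (`fanFromLaws_holds` and its helpers); `|λ| ≤ 1` is
the tree's `Literature.NumberTheory.Sieve.abs_liouville_le_one`.
-/

namespace Summit.Parity.GeneralizedHardyLittlewood.Theorems.FanDecorrelation.FanFromLaws

open ArithmeticFunction

/-- Trivial bound `|R_k| ≤ (⌊√M⌋+1)·M²`: `Q` lags, each a sum of at most `M²` terms of modulus
at most `1`. [folklore] -/
theorem abs_fanSum_le (c : ℤ) (n n' M : ℕ) (k : ℤ) :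
    |∑ j ∈ Finset.Ico (Nat.sqrt M + 1) (2 * (Nat.sqrt M + 1)),
        ∑ p ∈ (Finset.Ioc M (2 * M) ×ˢ Finset.Ioc M (2 * M)).filter
            (fun p : ℕ × ℕ => (p.1 : ℤ) - p.2 = k * (j : ℤ)),
          (liouville (Int.toNat ((p.1 : ℤ) * n + c)) : ℝ) *
            (liouville (Int.toNat ((p.2 : ℤ) * n' + c)) : ℝ)| ≤
      ((Nat.sqrt M + 1 : ℕ) : ℝ) * (M : ℝ) ^ 2 := by
  -- adapted from `abs_fanSum_le` in Cruxes/FanDecorrelation/SketchIdeator1.lean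
  refine (Finset.abs_sum_le_sum_abs _ _).trans ?_
  have hinner : ∀ j ∈ Finset.Ico (Nat.sqrt M + 1) (2 * (Nat.sqrt M + 1)),
      |∑ p ∈ (Finset.Ioc M (2 * M) ×ˢ Finset.Ioc M (2 * M)).filter
          (fun p : ℕ × ℕ => (p.1 : ℤ) - p.2 = k * (j : ℤ)),
        (liouville (Int.toNat ((p.1 : ℤ) * n + c)) : ℝ) *
          (liouville (Int.toNat ((p.2 : ℤ) * n' + c)) : ℝ)| ≤ (M : ℝ) ^ 2 := by
    intro j _
    refine (Finset.abs_sum_le_sum_abs _ _).trans ?_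
    calc ∑ p ∈ (Finset.Ioc M (2 * M) ×ˢ Finset.Ioc M (2 * M)).filter
            (fun p : ℕ × ℕ => (p.1 : ℤ) - p.2 = k * (j : ℤ)),
            |(liouville (Int.toNat ((p.1 : ℤ) * n + c)) : ℝ) *
              (liouville (Int.toNat ((p.2 : ℤ) * n' + c)) : ℝ)|
          ≤ ∑ p ∈ (Finset.Ioc M (2 * M) ×ˢ Finset.Ioc M (2 * M)).filter
              (fun p : ℕ × ℕ => (p.1 : ℤ) - p.2 = k * (j : ℤ)), (1 : ℝ) := by
            refine Finset.sum_le_sum fun p _ => ?_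
            rw [abs_mul]
            exact mul_le_one₀ (Literature.NumberTheory.Sieve.abs_liouville_le_one _)
              (abs_nonneg _) (Literature.NumberTheory.Sieve.abs_liouville_le_one _)
      _ ≤ ∑ p ∈ Finset.Ioc M (2 * M) ×ˢ Finset.Ioc M (2 * M), (1 : ℝ) :=
            Finset.sum_le_sum_of_subset_of_nonneg (Finset.filter_subset _ _)
              (fun _ _ _ => zero_le_one)
      _ = (M : ℝ) ^ 2 := by
            rw [Finset.sum_const, Finset.card_product, Nat.card_Ioc, nsmul_eq_mul, mul_one]
            have : 2 * M - M = M := by omega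
            rw [this]; push_cast; ring
  calc ∑ j ∈ Finset.Ico (Nat.sqrt M + 1) (2 * (Nat.sqrt M + 1)),
          |∑ p ∈ (Finset.Ioc M (2 * M) ×ˢ Finset.Ioc M (2 * M)).filter
              (fun p : ℕ × ℕ => (p.1 : ℤ) - p.2 = k * (j : ℤ)),
            (liouville (Int.toNat ((p.1 : ℤ) * n + c)) : ℝ) *
              (liouville (Int.toNat ((p.2 : ℤ) * n' + c)) : ℝ)|
        ≤ ∑ j ∈ Finset.Ico (Nat.sqrt M + 1) (2 * (Nat.sqrt M + 1)), (M : ℝ) ^ 2 :=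
          Finset.sum_le_sum hinner
    _ = ((Nat.sqrt M + 1 : ℕ) : ℝ) * (M : ℝ) ^ 2 := by
          rw [Finset.sum_const, Nat.card_Ico, nsmul_eq_mul]
          have : 2 * (Nat.sqrt M + 1) - (Nat.sqrt M + 1) = Nat.sqrt M + 1 := by omega
          rw [this]

/-- Comparison of the two power bounds used in the assembly: `C₁ M^{e₁} ≤ C M^{e}` for
`M ≥ 1`, `C₁ ≤ C`, `0 ≤ C`, `e₁ ≤ e`. [folklore] -/
theorem const_rpow_le {C₁ C M e₁ e : ℝ} (hM : 1 ≤ M) (hC : C₁ ≤ C) (hC0 : 0 ≤ C) (he : e₁ ≤ e) :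
    C₁ * M ^ e₁ ≤ C * M ^ e := by
  -- adapted from `const_rpow_le` in Cruxes/FanDecorrelation/SketchIdeator1.lean
  have hpow : M ^ e₁ ≤ M ^ e := Real.rpow_le_rpow_of_exponent_le hM he
  have h0 : 0 ≤ M ^ e₁ := Real.rpow_nonneg (by linarith) _
  have h0' : 0 ≤ M ^ e := Real.rpow_nonneg (by linarith) _
  rcases le_or_gt C₁ 0 with hC1 | hC1
  · calc C₁ * M ^ e₁ ≤ 0 := by nlinarith
      _ ≤ C * M ^ e := mul_nonneg hC0 h0'
  · calc C₁ * M ^ e₁ ≤ C₁ * M ^ e := mul_le_mul_of_nonneg_left hpow hC1.le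
      _ ≤ C * M ^ e := mul_le_mul_of_nonneg_right hC h0'

/-- Fans are EMPTY for `k ≥ 2Q`: `k j ≥ 2Q·Q > 2M > m − m'`, so `R_k = 0`. [folklore] -/
theorem fanSum_eq_zero_of_le (c : ℤ) (n n' M : ℕ) (k : ℤ) (hk : (2 * (Nat.sqrt M + 1) : ℤ) ≤ k) :
    (∑ j ∈ Finset.Ico (Nat.sqrt M + 1) (2 * (Nat.sqrt M + 1)),
        ∑ p ∈ (Finset.Ioc M (2 * M) ×ˢ Finset.Ioc M (2 * M)).filter
            (fun p : ℕ × ℕ => (p.1 : ℤ) - p.2 = k * (j : ℤ)),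
          (liouville (Int.toNat ((p.1 : ℤ) * n + c)) : ℝ) *
            (liouville (Int.toNat ((p.2 : ℤ) * n' + c)) : ℝ)) = 0 := by
  -- adapted from `fanEmptyLargeK_holds` in Cruxes/FanDecorrelation/SketchIdeator1.lean
  refine Finset.sum_eq_zero fun j hj => Finset.sum_eq_zero fun p hp => ?_
  exfalso
  rw [Finset.mem_filter, Finset.mem_product, Finset.mem_Ioc, Finset.mem_Ioc] at hp
  rw [Finset.mem_Ico] at hj
  obtain ⟨⟨⟨_, h2⟩, ⟨h3, _⟩⟩, heq⟩ := hp
  have hQ : M < (Nat.sqrt M + 1) * (Nat.sqrt M + 1) := Nat.lt_succ_sqrt M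
  have hQ' : ((M : ℕ) : ℤ) < ((Nat.sqrt M + 1 : ℕ) : ℤ) * ((Nat.sqrt M + 1 : ℕ) : ℤ) := by
    exact_mod_cast hQ
  have hj' : ((Nat.sqrt M + 1 : ℕ) : ℤ) ≤ (j : ℤ) := by exact_mod_cast hj.1
  have hk' : 2 * ((Nat.sqrt M + 1 : ℕ) : ℤ) ≤ k := by push_cast; exact_mod_cast hk
  have hprod : 2 * ((Nat.sqrt M + 1 : ℕ) : ℤ) * ((Nat.sqrt M + 1 : ℕ) : ℤ) ≤ k * (j : ℤ) :=
    mul_le_mul hk' hj' (by positivity) (le_trans (by positivity) hk')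
  have h2' : (p.1 : ℤ) ≤ 2 * (M : ℤ) := by exact_mod_cast h2
  have h3' : (M : ℤ) + 1 ≤ (p.2 : ℤ) := by exact_mod_cast h3
  nlinarith

/-- Negative `k` is the swapped pair: `R_{−k}(n,n') = R_k(n',n)` (swap `(m,m') ↦ (m',m)`).
[folklore] -/
theorem fanSum_neg (c : ℤ) (n n' M : ℕ) (k : ℤ) :
    (∑ j ∈ Finset.Ico (Nat.sqrt M + 1) (2 * (Nat.sqrt M + 1)),
        ∑ p ∈ (Finset.Ioc M (2 * M) ×ˢ Finset.Ioc M (2 * M)).filter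
            (fun p : ℕ × ℕ => (p.1 : ℤ) - p.2 = -k * (j : ℤ)),
          (liouville (Int.toNat ((p.1 : ℤ) * n + c)) : ℝ) *
            (liouville (Int.toNat ((p.2 : ℤ) * n' + c)) : ℝ)) =
      ∑ j ∈ Finset.Ico (Nat.sqrt M + 1) (2 * (Nat.sqrt M + 1)),
        ∑ p ∈ (Finset.Ioc M (2 * M) ×ˢ Finset.Ioc M (2 * M)).filter
            (fun p : ℕ × ℕ => (p.1 : ℤ) - p.2 = k * (j : ℤ)),
          (liouville (Int.toNat ((p.1 : ℤ) * n' + c)) : ℝ) *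
            (liouville (Int.toNat ((p.2 : ℤ) * n + c)) : ℝ) := by
  -- adapted from `fanSumNeg_holds` in Cruxes/FanDecorrelation/SketchIdeator1.lean
  refine Finset.sum_congr rfl fun j _ => ?_
  refine Finset.sum_nbij' Prod.swap Prod.swap ?_ ?_ (fun _ _ => rfl) (fun _ _ => rfl) ?_
  · intro p hp
    rw [Finset.mem_filter, Finset.mem_product] at hp ⊢
    refine ⟨⟨hp.1.2, hp.1.1⟩, ?_⟩
    simp only [Prod.fst_swap, Prod.snd_swap]
    linarith [hp.2]
  · intro p hp
    rw [Finset.mem_filter, Finset.mem_product] at hp ⊢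
    refine ⟨⟨hp.1.2, hp.1.1⟩, ?_⟩
    simp only [Prod.fst_swap, Prod.snd_swap]
    linarith [hp.2]
  · intro p _
    simp only [Prod.fst_swap, Prod.snd_swap]
    ring

/-- **Transfer (stub `stub_fanFromLaws`, line `SketchIdeator1` of the crux `FanDecorrelation`).**
Residue splitting (`R_k = Σ_{r<k} U_r` for `1 ≤ k ≤ M`, hypothesis 1), the lag-window law at
`δ > 0` (`|U_r| ≤ C₁ M^{1−κ}/k` for `1 ≤ k ≤ M^{1/2−δ}`, `r < k`, some `κ > 0`) and the fan-window
coset law at the same `δ` (`|Σ_{r<q} U_r| ≤ C₂ M^{3/4+ϑ₂}` for `M^{1/2−δ} ≤ q < 2Q`, some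
`ϑ₂ < 1/4`) imply: for every `c ≠ 0` there are `ϑ < 1/4` and `C` with
`|R_k(n,n',c;M)| ≤ C M^{3/4+ϑ}` for all `1 ≤ n ≠ n' ≤ 2M` and all `k ≠ 0` — the body of the route
declaration `Summit.Parity.GeneralizedHardyLittlewood.Theses.LiouvilleMAD.FanDecorrelation`.
Bookkeeping: `ϑ = max(ϑ₂, 1/4 − κ, 0)`, `C = max(C₁, C₂, 512)`; small `k` by summing the per-class
bound over `r < k`, `M^{1/2−δ} < k < 2Q` by the coset law with `q = k`, `k ≥ 2Q` empty, `k < 0` by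
the swap, `M < 8` by the trivial bound. [folklore] -/
theorem stub_fanFromLaws :
    (∀ (c : ℤ) (n n' M k : ℕ), 1 ≤ k → k ≤ M →
      (∑ j ∈ Finset.Ico (Nat.sqrt M + 1) (2 * (Nat.sqrt M + 1)),
          ∑ p ∈ (Finset.Ioc M (2 * M) ×ˢ Finset.Ioc M (2 * M)).filter
              (fun p : ℕ × ℕ => (p.1 : ℤ) - p.2 = (k : ℤ) * (j : ℤ)),
            (ArithmeticFunction.liouville (Int.toNat ((p.1 : ℤ) * n + c)) : ℝ) *
              (ArithmeticFunction.liouville (Int.toNat ((p.2 : ℤ) * n' + c)) : ℝ)) =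
        ∑ r ∈ Finset.range k,
          ∑ p ∈ (Finset.Ioc ((M - r) / k) ((2 * M - r) / k) ×ˢ
                  Finset.Ioc ((M - r) / k) ((2 * M - r) / k)).filter
              (fun p : ℕ × ℕ => (Nat.sqrt M : ℤ) + 1 ≤ (p.1 : ℤ) - p.2 ∧
                (p.1 : ℤ) - p.2 < 2 * ((Nat.sqrt M : ℤ) + 1)),
            (ArithmeticFunction.liouville (Int.toNat (((k : ℤ) * p.1 + r) * n + c)) : ℝ) *
              (ArithmeticFunction.liouville (Int.toNat (((k : ℤ) * p.2 + r) * n' + c)) : ℝ)) →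
    ∀ δ : ℝ, 0 < δ →
    (∀ c : ℤ, c ≠ 0 → ∃ κ : ℝ, 0 < κ ∧ ∃ C : ℝ, ∀ M n n' k r : ℕ,
      1 ≤ n → 1 ≤ n' → n ≠ n' → n ≤ 2 * M → n' ≤ 2 * M → 1 ≤ k →
        (k : ℝ) ≤ (M : ℝ) ^ (1 / 2 - δ) → r < k →
          |∑ p ∈ (Finset.Ioc ((M - r) / k) ((2 * M - r) / k) ×ˢ
                  Finset.Ioc ((M - r) / k) ((2 * M - r) / k)).filter
              (fun p : ℕ × ℕ => (Nat.sqrt M : ℤ) + 1 ≤ (p.1 : ℤ) - p.2 ∧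
                (p.1 : ℤ) - p.2 < 2 * ((Nat.sqrt M : ℤ) + 1)),
            (ArithmeticFunction.liouville (Int.toNat (((k : ℤ) * p.1 + r) * n + c)) : ℝ) *
              (ArithmeticFunction.liouville (Int.toNat (((k : ℤ) * p.2 + r) * n' + c)) : ℝ)| ≤
            C * (M : ℝ) ^ (1 - κ) / k) →
    (∀ c : ℤ, c ≠ 0 → ∃ ϑ : ℝ, ϑ < 1 / 4 ∧ ∃ C : ℝ, ∀ M n n' q : ℕ,
      1 ≤ n → 1 ≤ n' → n ≠ n' → n ≤ 2 * M → n' ≤ 2 * M →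
        (M : ℝ) ^ (1 / 2 - δ) ≤ q → q < 2 * (Nat.sqrt M + 1) →
          |∑ r ∈ Finset.range q,
              ∑ p ∈ (Finset.Ioc ((M - r) / q) ((2 * M - r) / q) ×ˢ
                      Finset.Ioc ((M - r) / q) ((2 * M - r) / q)).filter
                  (fun p : ℕ × ℕ => (Nat.sqrt M : ℤ) + 1 ≤ (p.1 : ℤ) - p.2 ∧
                    (p.1 : ℤ) - p.2 < 2 * ((Nat.sqrt M : ℤ) + 1)),
                (ArithmeticFunction.liouville (Int.toNat (((q : ℤ) * p.1 + r) * n + c)) : ℝ) *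
                  (ArithmeticFunction.liouville (Int.toNat (((q : ℤ) * p.2 + r) * n' + c)) : ℝ)| ≤
            C * (M : ℝ) ^ (3 / 4 + ϑ)) →
    ∀ c : ℤ, c ≠ 0 → ∃ ϑ : ℝ, ϑ < 1 / 4 ∧ ∃ C : ℝ, ∀ M n n' : ℕ, ∀ k : ℤ,
      1 ≤ n → 1 ≤ n' → n ≠ n' → n ≤ 2 * M → n' ≤ 2 * M → k ≠ 0 →
        |∑ j ∈ Finset.Ico (Nat.sqrt M + 1) (2 * (Nat.sqrt M + 1)),
            ∑ p ∈ (Finset.Ioc M (2 * M) ×ˢ Finset.Ioc M (2 * M)).filter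
                (fun p : ℕ × ℕ => (p.1 : ℤ) - p.2 = k * (j : ℤ)),
              (ArithmeticFunction.liouville (Int.toNat ((p.1 : ℤ) * n + c)) : ℝ) *
                (ArithmeticFunction.liouville (Int.toNat ((p.2 : ℤ) * n' + c)) : ℝ)| ≤
          C * (M : ℝ) ^ (3 / 4 + ϑ) := by
  -- adapted from `fanFromLaws_holds` in Cruxes/FanDecorrelation/SketchIdeator1.lean
  intro hRS δ hδ hLW hWC c hc
  obtain ⟨κ, hκ, C₁, h₁⟩ := hLW c hc
  obtain ⟨ϑ₂, hϑ₂, C₂, h₂⟩ := hWC c hc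
  set ϑ : ℝ := max (max ϑ₂ (1 / 4 - κ)) 0 with hϑdef
  have hϑlt : ϑ < 1 / 4 := by
    simp only [hϑdef, max_lt_iff]; exact ⟨⟨hϑ₂, by linarith⟩, by norm_num⟩
  have hϑ0 : 0 ≤ ϑ := le_max_right _ _
  have hϑ2le : 3 / 4 + ϑ₂ ≤ 3 / 4 + ϑ := by
    have : ϑ₂ ≤ ϑ := (le_max_left _ _).trans (le_max_left _ _); linarith
  have hκle : 1 - κ ≤ 3 / 4 + ϑ := by
    have : 1 / 4 - κ ≤ ϑ := (le_max_right _ _).trans (le_max_left _ _); linarith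
  set C : ℝ := max (max C₁ C₂) 512 with hCdef
  have hC0 : (0 : ℝ) ≤ C := le_trans (by norm_num) (le_max_right _ _)
  have hC1 : C₁ ≤ C := (le_max_left _ _).trans (le_max_left _ _)
  have hC2 : C₂ ≤ C := (le_max_right _ _).trans (le_max_left _ _)
  refine ⟨ϑ, hϑlt, C, ?_⟩
  -- the claim for `k ≥ 1`, symmetric in `(n, n')`
  have key : ∀ M n n' k : ℕ, 1 ≤ n → 1 ≤ n' → n ≠ n' → n ≤ 2 * M → n' ≤ 2 * M → 1 ≤ k →
      |∑ j ∈ Finset.Ico (Nat.sqrt M + 1) (2 * (Nat.sqrt M + 1)),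
          ∑ p ∈ (Finset.Ioc M (2 * M) ×ˢ Finset.Ioc M (2 * M)).filter
              (fun p : ℕ × ℕ => (p.1 : ℤ) - p.2 = (k : ℤ) * (j : ℤ)),
            (liouville (Int.toNat ((p.1 : ℤ) * n + c)) : ℝ) *
              (liouville (Int.toNat ((p.2 : ℤ) * n' + c)) : ℝ)| ≤ C * (M : ℝ) ^ (3 / 4 + ϑ) := by
    intro M n n' k hn hn' hnn' hnM hn'M hk
    have hMpos : 1 ≤ M := by omega
    have hM1 : (1 : ℝ) ≤ M := by exact_mod_cast hMpos
    have hMe : (1 : ℝ) ≤ (M : ℝ) ^ (3 / 4 + ϑ) := Real.one_le_rpow hM1 (by linarith)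
    by_cases hM8 : M < 8
    · -- small `M`: trivial bound
      have hs : Nat.sqrt M < 3 := Nat.sqrt_lt'.mpr (by omega)
      calc _ ≤ ((Nat.sqrt M + 1 : ℕ) : ℝ) * (M : ℝ) ^ 2 := abs_fanSum_le _ _ _ _ _
        _ ≤ 3 * (7 : ℝ) ^ 2 := by
            refine mul_le_mul ?_ ?_ (by positivity) (by norm_num)
            · exact_mod_cast (show Nat.sqrt M + 1 ≤ 3 by omega)
            · exact pow_le_pow_left₀ (by positivity) (by exact_mod_cast (show M ≤ 7 by omega)) 2
        _ ≤ C := le_trans (by norm_num) (le_max_right _ _)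
        _ ≤ C * (M : ℝ) ^ (3 / 4 + ϑ) := le_mul_of_one_le_right hC0 hMe
    · push Not at hM8
      by_cases hsmall : (k : ℝ) ≤ (M : ℝ) ^ (1 / 2 - δ)
      · -- regime I: residue classes one at a time
        have hkM : k ≤ M := by
          have h' : (M : ℝ) ^ (1 / 2 - δ) ≤ (M : ℝ) ^ (1 : ℝ) :=
            Real.rpow_le_rpow_of_exponent_le hM1 (by linarith)
          rw [Real.rpow_one] at h'
          exact_mod_cast hsmall.trans h'
        rw [hRS c n n' M k hk hkM]
        have hkR : (k : ℝ) ≠ 0 := by exact_mod_cast (show k ≠ 0 by omega)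
        calc _ ≤ ∑ r ∈ Finset.range k,
              |∑ p ∈ (Finset.Ioc ((M - r) / k) ((2 * M - r) / k) ×ˢ
                      Finset.Ioc ((M - r) / k) ((2 * M - r) / k)).filter
                  (fun p : ℕ × ℕ => (Nat.sqrt M : ℤ) + 1 ≤ (p.1 : ℤ) - p.2 ∧
                    (p.1 : ℤ) - p.2 < 2 * ((Nat.sqrt M : ℤ) + 1)),
                (liouville (Int.toNat (((k : ℤ) * p.1 + r) * n + c)) : ℝ) *
                  (liouville (Int.toNat (((k : ℤ) * p.2 + r) * n' + c)) : ℝ)| :=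
              Finset.abs_sum_le_sum_abs _ _
          _ ≤ ∑ r ∈ Finset.range k, C₁ * (M : ℝ) ^ (1 - κ) / k :=
              Finset.sum_le_sum fun r hr =>
                h₁ M n n' k r hn hn' hnn' hnM hn'M hk hsmall (Finset.mem_range.mp hr)
          _ = C₁ * (M : ℝ) ^ (1 - κ) := by
              rw [Finset.sum_const, Finset.card_range, nsmul_eq_mul]
              field_simp
          _ ≤ C * (M : ℝ) ^ (3 / 4 + ϑ) := const_rpow_le hM1 hC1 hC0 hκle
      · -- regime II (windowed coset law) or empty fan
        push Not at hsmall
        by_cases hbig : (2 * (Nat.sqrt M + 1) : ℤ) ≤ (k : ℤ)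
        · rw [fanSum_eq_zero_of_le c n n' M k hbig, abs_zero]
          exact mul_nonneg hC0 (le_trans zero_le_one hMe)
        · push Not at hbig
          have hk2Q : k < 2 * (Nat.sqrt M + 1) := by exact_mod_cast hbig
          have hsq := Nat.sqrt_le M
          have hkM : k ≤ M := by
            rcases le_or_gt 3 (Nat.sqrt M) with h3 | h3
            · nlinarith
            · omega
          rw [hRS c n n' M k hk hkM]
          exact (h₂ M n n' k hn hn' hnn' hnM hn'M hsmall.le hk2Q).trans
            (const_rpow_le hM1 hC2 hC0 hϑ2le)
  -- all `k ≠ 0`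
  intro M n n' k hn hn' hnn' hnM hn'M hk0
  rcases lt_or_gt_of_ne hk0 with hneg | hpos
  · obtain ⟨k', hk'⟩ : ∃ k' : ℕ, k = -(k' : ℤ) := ⟨k.natAbs, by omega⟩
    have hk'1 : 1 ≤ k' := by omega
    rw [hk', fanSum_neg c n n' M (k' : ℤ)]
    exact key M n' n k' hn' hn hnn'.symm hn'M hnM hk'1
  · obtain ⟨k', hk'⟩ : ∃ k' : ℕ, k = (k' : ℤ) := ⟨k.natAbs, by omega⟩
    have hk'1 : 1 ≤ k' := by omega
    rw [hk']
    exact key M n n' k' hn hn' hnn' hnM hn'M hk'1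

end Summit.Parity.GeneralizedHardyLittlewood.Theorems.FanDecorrelation.FanFromLaws
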